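import Summits.ABC.IUTFork.Repair.RHInSigmaDatum
import Summits.ABC.IUTFork.Cor312LicenceShallowRealising
import Summits.ABC.IUTFork.Cor312LicenceShallowMultiSlotGenuineKInhabited
import Summits.ABC.IUTFork.Conditional.AbcOfSGenuineAntecedent
import HarnessLib

/-!
# R-H ROUND 2, Q2 row 8 «heightclass» at REALISING ideles — the idele profile of the row-8 door DISCHARGED:
# `HBand X` ⟹ S_H / the all-labels licence at `settingPrVolSharp` for ANY ideles realising the pilot divisors (integer `P_q` on `S`),
# hence at the genuine bed `pilotDataOfK D K` for its CHOSEN realising ideles with NO residual hypothesis beyond `InSigma8 D`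

PROOF-ONLY file (D-0012: 0 definitions, 0 `Prop` facts) of the abc-iut cell, rung LADDER-ABC:A2.RP → A2.RESCUE.H (seat abc-iut-rp-m2 gen 6 =
R-H k2 DESK hand #8, row 8). The row-8 door p467352 `RHHeightClassK2.exists_qPinned_and_hull_settingPrVolSharp_of_hBand` (and abc-iut-rh2-xi-2's
genuine-bed copy p470383 `RH.InSigmaDatum.exists_qPinned_and_hull_pilotDataOfK_of_inSigma8`) carries the SHARP IDELE PROFILE as hypotheses:
`‖t_q‖ ≤ 1`, `‖t_Θ‖ = 1` off `S`, INTEGER Kummer orders `m_q(w) = P_q(w)`, norms `‖t_{q,w}‖ = p^{−m_q/e_w}`, `‖t_{Θ,j,w}‖ = p^{−j²m_q/e_w}`. This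
file DISCHARGES that profile for ideles REALISING the pilot divisors in Dupuy–Hilado's normalisation (3.4) — the `ht`/`htq` hypotheses the
branch-C certificates carry — using abc-iut-w5-d236's `Thm311.Real.norm_qIdele_eq_rpow_of_realises` / `norm_thetaIdele_eq_rpow_of_realises` (p-th
power norms from the log-norm identities) and, at the genuine `K`-level bed, abc-iut-w5-d107's `Cor312Prov.exists_nat_qPilot_pilotDataOfK`
(`P_q(w) ∈ ℕ`: [IUTchI] Ex. 3.2 (iv), `2l ∣ ord_w(q)`), everything BY NAME.

* §1 (any pilot datum `X`, realising ideles, `P_q(w) ∈ ℕ` on `S`): **`exists_qPinned_and_hull_settingPrVolSharp_of_hBand_of_realises`** —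
  `HBand X` ⟹ «`∃ ρ qK, QPinned ∧ PilotKummerCompatHull`» at `settingPrVolSharp` (any columns), and its unbundled form
  `qRegion_subset_thetaHull_settingPrVolSharp_of_hBand_of_realises` (the (xi-f) licence at EVERY label, incl. `0`).
* §2 (the genuine bed `X := pilotDataOfK D K`, ANY realising ideles over `K`): **`exists_qPinned_and_hull_pilotDataOfK_of_inSigma8_of_realises`** —
  `InSigma8 D` ⟹ the bundle; the integrality is a theorem there.
* §3 (the CHOSEN realising ideles `(exists_realising_qIdeles_pilotDataOfK D).choose` / `(exists_realising_thetaIdeles_pilotDataOfK D).choose` of the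
  certificates of record `Conditional.abc_of_SH_v10K_window` / `abc_of_SHSigma_v10K_window`, coric shells `logShellsDH _ (analyticLogv K)`):
  **`exists_qPinned_and_hull_pilotDataOfK_chosen_of_inSigma8`** and **`qRegion_subset_thetaHull_pilotDataOfK_chosen_of_inSigma8`** — `InSigma8 D`
  ALONE gives the `hSHw` / `hSHsw` body (`PilotKummerCompatHull _ _ (fun _ => qRegion) qK` unfolds to the all-labels licence) at that datum:
  for data in the height class the S_H binder of the certificates is a THEOREM, not a hypothesis (row 8 = a DATUM stratum; Q1 «MOOT-ON-DATUM-Σ»).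
HONEST SCOPE: OUR typed sharp containers and Dupuy–Hilado's typed (Ind2); STRONGER-THAN-PRINT hull reading (ADJUDICATION-SPEC §2 (G1′)); nothing
here says WHICH genuine data satisfy `InSigma8` (k1 / round-2 Q3 tables: abc-iut-rh-num-1 / rh2-q3-num), nothing about the printed GLOBAL inequality.

TAKES NO SIDE on [IUTchIII] Cor. 3.12 or on any author; `HBand` / `InSigma8` are HYPOTHESES (claim-tagged defs of their typers), never asserted;
nothing asserts abc proved or refuted; typed ≠ proved; instantiated ≠ endorsed. [cite: Mochizuki2012, IUTchI Ex. 3.2 (iv) p. 71; IUTchIII Cor.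
3.12 p. 173–174, Step (xi-f) p. 184; IUTchIV Prop. 1.2 (i) p. 10] [cite: DupuyHilado2025, §3.3, §3.4, §3.9, §4.9] [cite: NeukirchANT1999, Ch. I §8
Prop. (8.2), Ch. II Prop. (5.5)] [claim: Mochizuki2012, status: disputed] for every IUT locution. Axioms: standard.
-/

noncomputable section

open Set Metric Function
open scoped Pointwise

namespace Summit.ABC.IUTFork.Repair.RHHeightClassRealising

open NumberField IsDedekindDomain Literature.IUT.LogThetaLattice Literature.IUT.LogVolume Literature.IUT.HodgeTheaters
  Literature.IUT.LogVolume.ThetaData Literature.NumberTheory.NumberFields Literature.NumberTheory.GaloisRepresentations.Ultrametric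
  Summit.ABC.IUTFork.Thm311 Summit.ABC.IUTFork.Thm311.Real Summit.ABC.IUTFork.Cor312 Summit.ABC.IUTFork.Cor312.Setting
  Summit.ABC.IUTFork.Cor312Vol Summit.ABC.IUTFork.Cor312Prov

/-! ## §1. Any pilot datum: the door's idele profile from REALISING ideles with integer `P_q` on `S` -/

section AnyDatum

variable {F : Type} [Field F] [NumberField F] (X : PilotData F) {logv : PadicLogs F} (hlog : LogvAnalytic logv)
  (M : Type) [Field M] [NumberField M]
  (archPk : ∀ (j : (thetaIndex X).Label) (vQ : (thetaIndex X).VQ), Set ((logShellsDH X logv).Packet j vQ))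
  (archSub : ∀ (j : (thetaIndex X).Label) (v : (thetaIndex X).V),
    Set ((logShellsDH X logv).Packet j ((thetaIndex X).over v)))
  (Ψ : ℤ → ∀ v : (thetaIndex X).V, v ∈ (thetaIndex X).Vbad → Set ((logShellsDH X logv).StarPacket v))
  (act : ℤ → ∀ v : (thetaIndex X).V, v ∈ (thetaIndex X).Vbad →
    (logShellsDH X logv).StarPacket v → Module.End ℚ ((logShellsDH X logv).StarPacket v))
  (Mmod : ℤ → ∀ j : (thetaIndex X).LabelStar, Set ((logShellsDH X logv).GlobalPacket j.1))
  (region : ℤ → ∀ j : (thetaIndex X).LabelStar, FinDivisor M → ∀ vQ : (thetaIndex X).VQ,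
    Set ((logShellsDH X logv).Packet j.1 vQ))
  (n : ℤ) {HT : Type} {LogLink : HT → HT → Type} {IsFull : ∀ {s t : HT}, LogLink s t → Prop}
  (lat : LGPGaussianLogThetaLattice LogLink IsFull)
  {Frd : Type} {IsoF : Frd → Frd → Type} {Ob : Frd → Type} {realify : Frd → Frd} {Strip : Type}
  {IsoS : Strip → Strip → Type} {Mv : ∀ v : (thetaIndex X).V, v ∈ (thetaIndex X).Vbad → Type}
  [∀ v h, Monoid (Mv v h)]
  (sig : GlobalLGPFrobenioidSignature (thetaIndex X).lstar (thetaIndex X).V (· ∈ (thetaIndex X).Vbad)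
    Frd IsoF Ob realify Strip IsoS Mv)
  (split : SplittingMonoids Mv) {ObΔ : Type} {N : ∀ v : (thetaIndex X).V, v ∈ (thetaIndex X).Vbad → Type}
  [∀ v h, Monoid (N v h)] (qData : QPilotData ObΔ N)
  (tq : ∀ (pp : Nat.Primes) (x : (thetaIndex X).Fibre (.inr pp)), haveI : Fact (pp : ℕ).Prime := ⟨pp.2⟩; kOf X pp.1 x)
  (t : ∀ (pp : Nat.Primes) (_ : Fin X.lstar) (x : (thetaIndex X).Fibre (.inr pp)),
    haveI : Fact (pp : ℕ).Prime := ⟨pp.2⟩; kOf X pp.1 x)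
  (htq0 : ∀ pp x, tq pp x ≠ 0)
  (htq1 : ∀ (pp : Nat.Primes) (x : (thetaIndex X).Fibre (.inr pp)),
    haveI : Fact (pp : ℕ).Prime := ⟨pp.2⟩; placeOf X pp.1 x ∉ X.S → ‖tq pp x‖ = 1)
  (col : ℤ → Column (logShellsDH X logv))

/-- **ROW 8 AT REALISING IDELES (any pilot datum).** If the Θ- and q-ideles REALISE the pilot divisors in Dupuy–Hilado's normalisation
(`log ‖t_{Θ,i,x}‖ = −P_{Θ,i}(x)·ln|κ(x)|/n_x`, `log ‖t_{q,x}‖ = −P_q(x)·ln|κ(x)|/n_x` — the `ht`/`htq` binders of the branch-C certificates) and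
`P_q(w) ∈ ℕ` at every `w ∈ S` (genuine data: `Cor312Prov.exists_nat_qPilot_pilotDataOfK`), then the idele profile of p467352 holds —
`‖t_q‖ = p^{−P_q/e} ≤ 1`, `‖t_Θ‖ = 1` off `S` (`P_q = 0` there), `m_q := P_q`, `‖t_{Θ,i}‖ = p^{−(i+1)²P_q/e}` (abc-iut-w5-d236's
`norm_qIdele_eq_rpow_of_realises` / `norm_thetaIdele_eq_rpow_of_realises`) — so **`HBand X` ⟹ «`∃ ρ qK, QPinned ∧ PilotKummerCompatHull`» at
`settingPrVolSharp`** (any columns). [cite: DupuyHilado2025, §3.3, §3.4, §3.9] [claim: Mochizuki2012, status: disputed] -/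
theorem exists_qPinned_and_hull_settingPrVolSharp_of_hBand_of_realises
    (ht0 : ∀ pp i x, t pp i x ≠ 0)
    (ht : ∀ (pp : Nat.Primes) (i : Fin X.lstar) (x : (thetaIndex X).Fibre (.inr pp)),
      haveI : Fact (pp : ℕ).Prime := ⟨pp.2⟩
      Real.log ‖t pp i x‖ = -(X.thetaPilot i (placeOf X pp.1 x)) * logNorm F (placeOf X pp.1 x) /
        localDegree F (placeOf X pp.1 x))
    (htq : ∀ (pp : Nat.Primes) (x : (thetaIndex X).Fibre (.inr pp)),
      haveI : Fact (pp : ℕ).Prime := ⟨pp.2⟩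
      Real.log ‖tq pp x‖ = -(X.qPilot (placeOf X pp.1 x)) * logNorm F (placeOf X pp.1 x) /
        localDegree F (placeOf X pp.1 x))
    (hint : ∀ w ∈ X.S, ∃ m : ℕ, X.qPilot w = m)
    (hH : RHHeightClass.HBand X) :
    ∃ (ρ' : (∀ v : (thetaIndex X).V, v ∈ (thetaIndex X).Vbad → Set ((logShellsDH X logv).StarPacket v)) →
          ∀ (j : (thetaIndex X).Label) (vQ : (thetaIndex X).VQ), Set ((logShellsDH X logv).Packet j vQ))
        (qK : ∀ v : (thetaIndex X).V, v ∈ (thetaIndex X).Vbad → Set ((logShellsDH X logv).StarPacket v)),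
        QPinned ({ toSituation := situationPrVol X hlog M archPk archSub Ψ act Mmod region, col := col } :
            LatticeSituation (thetaIndex X))
          (settingPrVolSharp X hlog M archPk archSub Ψ act Mmod region n lat sig split qData tq t htq0 htq1) ρ' qK ∧
        PilotKummerCompatHull ({ toSituation := situationPrVol X hlog M archPk archSub Ψ act Mmod region, col := col } :
            LatticeSituation (thetaIndex X))
          (settingPrVolSharp X hlog M archPk archSub Ψ act Mmod region n lat sig split qData tq t htq0 htq1) ρ' qK := by
  classical
  haveI hne : ∀ pp : Nat.Primes, Fact (pp : ℕ).Prime := fun pp => ⟨pp.2⟩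
  have hp1 : ∀ pp : Nat.Primes, (1 : ℝ) ≤ ((pp : ℕ) : ℝ) := fun pp => by exact_mod_cast pp.2.one_lt.le
  -- `0 ≤ P_q(v)` everywhere
  have hqnn : ∀ v, 0 ≤ X.qPilot v := fun v => by
    by_cases hv : v ∈ X.S
    · rw [X.qPilot_apply_of_mem hv]
      exact div_nonneg (by exact_mod_cast (X.ordq_pos hv).le) X.two_mul_l_pos.le
    · rw [X.qPilot_apply_of_not_mem hv]
  -- the norms of the realising ideles as powers of `p`
  have hnq : ∀ (pp : Nat.Primes) (x : (thetaIndex X).Fibre (.inr pp)),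
      ‖tq pp x‖ = ((pp : ℕ) : ℝ) ^ (-(X.qPilot (placeOf X pp.1 x)) / (ramIdx F (placeOf X pp.1 x) : ℝ)) :=
    fun pp x => norm_qIdele_eq_rpow_of_realises (X := X) (tq := tq) (htq0 := htq0) (htq := htq) pp x
  have hnΘ : ∀ (pp : Nat.Primes) (i : Fin X.lstar) (x : (thetaIndex X).Fibre (.inr pp)),
      ‖t pp i x‖ = ((pp : ℕ) : ℝ) ^ (-((((i : ℕ) + 1 : ℕ) : ℝ) ^ 2 * X.qPilot (placeOf X pp.1 x)) /
        (ramIdx F (placeOf X pp.1 x) : ℝ)) :=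
    fun pp i x => norm_thetaIdele_eq_rpow_of_realises (X := X) (tq := tq) (t := t) (htq0 := htq0) (ht0 := ht0) (ht := ht)
      (htq := htq) pp i x
  -- integer Kummer orders `m_q := P_q` on `S` (and `0` elsewhere)
  set mq : ∀ pp : Nat.Primes, (thetaIndex X).Fibre (.inr pp) → ℤ := fun pp w =>
    if h : placeOf X pp.1 w ∈ X.S then ((hint _ h).choose : ℤ) else 0 with hmqdef
  have hmq : ∀ (pp : Nat.Primes) (w : (thetaIndex X).Fibre (.inr pp)),
      placeOf X pp.1 w ∈ X.S → (mq pp w : ℝ) = X.qPilot (placeOf X pp.1 w) := by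
    intro pp w hw
    rw [hmqdef]
    dsimp only
    rw [dif_pos hw]
    push_cast
    exact (hint _ hw).choose_spec.symm
  refine RHHeightClassK2.exists_qPinned_and_hull_settingPrVolSharp_of_hBand X hlog M archPk archSub Ψ act Mmod region n lat sig split
    qData tq t htq0 htq1 col (fun pp x => ?_) (fun pp i x hx => ?_) mq hmq (fun pp w hw => ?_) (fun pp i w hw => ?_) hH
  · -- `‖t_q‖ ≤ 1`
    rw [hnq]
    refine Real.rpow_le_one_of_one_le_of_nonpos (hp1 pp) ?_
    have h0 := hqnn (placeOf X pp.1 x)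
    have he : (0 : ℝ) ≤ (ramIdx F (placeOf X pp.1 x) : ℝ) := Nat.cast_nonneg _
    exact div_nonpos_of_nonpos_of_nonneg (by linarith) he
  · -- `‖t_Θ‖ = 1` off `S`
    rw [hnΘ, X.qPilot_apply_of_not_mem hx, mul_zero, neg_zero, zero_div, Real.rpow_zero]
  · -- `‖t_q‖ = p^{−m_q/e}` at a bad place
    rw [hnq, ← hmq pp w hw]
  · -- `‖t_Θ‖ = p^{−(i+1)²·m_q/e}` at a bad place
    rw [hnΘ, ← hmq pp w hw]
    congr 1
    push_cast
    ring

include col in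
/-- **The unbundled form: the (xi-f) licence at EVERY label (incl. `0`)** at `settingPrVolSharp` for realising ideles with integer `P_q` on `S`,
from `HBand X` (C-cert-1's `Conditional.Antecedent.exists_qPinned_and_hull_iff`). This is what `PilotKummerCompatHull _ _ (fun _ => qRegion) qK`
— the `hSHw` body of `Conditional.abc_of_SH_v10K_window` — unfolds to (the columns `col` only package the bundle). [claim: Mochizuki2012, status: disputed] -/
theorem qRegion_subset_thetaHull_settingPrVolSharp_of_hBand_of_realises
    (ht0 : ∀ pp i x, t pp i x ≠ 0)
    (ht : ∀ (pp : Nat.Primes) (i : Fin X.lstar) (x : (thetaIndex X).Fibre (.inr pp)),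
      haveI : Fact (pp : ℕ).Prime := ⟨pp.2⟩
      Real.log ‖t pp i x‖ = -(X.thetaPilot i (placeOf X pp.1 x)) * logNorm F (placeOf X pp.1 x) /
        localDegree F (placeOf X pp.1 x))
    (htq : ∀ (pp : Nat.Primes) (x : (thetaIndex X).Fibre (.inr pp)),
      haveI : Fact (pp : ℕ).Prime := ⟨pp.2⟩
      Real.log ‖tq pp x‖ = -(X.qPilot (placeOf X pp.1 x)) * logNorm F (placeOf X pp.1 x) /
        localDegree F (placeOf X pp.1 x))
    (hint : ∀ w ∈ X.S, ∃ m : ℕ, X.qPilot w = m)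
    (hH : RHHeightClass.HBand X) (j : (thetaIndex X).Label) (vQ : (thetaIndex X).VQ) :
    (settingPrVolSharp X hlog M archPk archSub Ψ act Mmod region n lat sig split qData tq t htq0 htq1).qRegion j vQ ⊆
      (settingPrVolSharp X hlog M archPk archSub Ψ act Mmod region n lat sig split qData tq t htq0 htq1).thetaHull j vQ :=
  (Conditional.Antecedent.exists_qPinned_and_hull_iff
    ({ toSituation := situationPrVol X hlog M archPk archSub Ψ act Mmod region, col := col } : LatticeSituation (thetaIndex X))
    (settingPrVolSharp X hlog M archPk archSub Ψ act Mmod region n lat sig split qData tq t htq0 htq1)).1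
    (exists_qPinned_and_hull_settingPrVolSharp_of_hBand_of_realises X hlog M archPk archSub Ψ act Mmod region n lat sig split qData tq t
      htq0 htq1 col ht0 ht htq hint hH) j vQ

end AnyDatum

/-! ## §2. The genuine `K`-level bed `pilotDataOfK D K`: integrality of `P_q` is a theorem — ANY realising ideles -/

section Genuine

variable {F K Fbar : Type} [Field F] [NumberField F] [Field K] [NumberField K] [Algebra F K] [Field Fbar]
  [Algebra F Fbar] [Algebra K Fbar] {E : WeierstrassCurve F} [E.IsElliptic] {l : ℕ} {Pb : BadPlacePredicates K}
  (D : InitialThetaData F K Fbar E l Pb) (M : Type) [Field M] [NumberField M] {logv : PadicLogs K} (hlog : LogvAnalytic logv)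
  (archPk : ∀ (j : (thetaIndex (pilotDataOfK D K)).Label) (vQ : (thetaIndex (pilotDataOfK D K)).VQ),
    Set ((logShellsDH (pilotDataOfK D K) logv).Packet j vQ))
  (archSub : ∀ (j : (thetaIndex (pilotDataOfK D K)).Label) (v : (thetaIndex (pilotDataOfK D K)).V),
    Set ((logShellsDH (pilotDataOfK D K) logv).Packet j ((thetaIndex (pilotDataOfK D K)).over v)))
  (Ψ : ℤ → ∀ v : (thetaIndex (pilotDataOfK D K)).V, v ∈ (thetaIndex (pilotDataOfK D K)).Vbad →
    Set ((logShellsDH (pilotDataOfK D K) logv).StarPacket v))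
  (act : ℤ → ∀ v : (thetaIndex (pilotDataOfK D K)).V, v ∈ (thetaIndex (pilotDataOfK D K)).Vbad →
    (logShellsDH (pilotDataOfK D K) logv).StarPacket v → Module.End ℚ ((logShellsDH (pilotDataOfK D K) logv).StarPacket v))
  (Mmod : ℤ → ∀ j : (thetaIndex (pilotDataOfK D K)).LabelStar, Set ((logShellsDH (pilotDataOfK D K) logv).GlobalPacket j.1))
  (region : ℤ → ∀ j : (thetaIndex (pilotDataOfK D K)).LabelStar, FinDivisor M → ∀ vQ : (thetaIndex (pilotDataOfK D K)).VQ,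
    Set ((logShellsDH (pilotDataOfK D K) logv).Packet j.1 vQ))
  (n : ℤ) {HT : Type} {LogLink : HT → HT → Type} {IsFull : ∀ {s t : HT}, LogLink s t → Prop}
  (lat : LGPGaussianLogThetaLattice LogLink IsFull)
  {Frd : Type} {IsoF : Frd → Frd → Type} {Ob : Frd → Type} {realify : Frd → Frd} {Strip : Type}
  {IsoS : Strip → Strip → Type}
  {Mv : ∀ v : (thetaIndex (pilotDataOfK D K)).V, v ∈ (thetaIndex (pilotDataOfK D K)).Vbad → Type} [∀ v h, Monoid (Mv v h)]
  (sig : GlobalLGPFrobenioidSignature (thetaIndex (pilotDataOfK D K)).lstar (thetaIndex (pilotDataOfK D K)).V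
    (· ∈ (thetaIndex (pilotDataOfK D K)).Vbad) Frd IsoF Ob realify Strip IsoS Mv)
  (split : SplittingMonoids Mv) {ObΔ : Type}
  {N : ∀ v : (thetaIndex (pilotDataOfK D K)).V, v ∈ (thetaIndex (pilotDataOfK D K)).Vbad → Type} [∀ v h, Monoid (N v h)]
  (qData : QPilotData ObΔ N)
  (tq : ∀ (pp : Nat.Primes) (x : (thetaIndex (pilotDataOfK D K)).Fibre (.inr pp)),
    haveI : Fact (pp : ℕ).Prime := ⟨pp.2⟩; kOf (pilotDataOfK D K) pp.1 x)
  (t : ∀ (pp : Nat.Primes) (_ : Fin (pilotDataOfK D K).lstar) (x : (thetaIndex (pilotDataOfK D K)).Fibre (.inr pp)),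
    haveI : Fact (pp : ℕ).Prime := ⟨pp.2⟩; kOf (pilotDataOfK D K) pp.1 x)
  (htq0 : ∀ pp x, tq pp x ≠ 0)
  (htq1 : ∀ (pp : Nat.Primes) (x : (thetaIndex (pilotDataOfK D K)).Fibre (.inr pp)),
    haveI : Fact (pp : ℕ).Prime := ⟨pp.2⟩; placeOf (pilotDataOfK D K) pp.1 x ∉ (pilotDataOfK D K).S → ‖tq pp x‖ = 1)
  (col : ℤ → Column (logShellsDH (pilotDataOfK D K) logv))

/-- **ROW 8 AT THE GENUINE BED, ANY REALISING IDELES.** For a genuine datum in the height class (`InSigma8 D`, abc-iut-rh2-xi-2 p470383 =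
`HBand (pilotDataOfK D K)`), ideles over `K` realising the pilot divisors give branch C's antecedent «`∃ ρ qK, QPinned ∧ PilotKummerCompatHull`» at
`settingPrVolSharp (pilotDataOfK D K) …` — the integrality `P_q(w) ∈ ℕ` being abc-iut-w5-d107's THEOREM `Cor312Prov.exists_nat_qPilot_pilotDataOfK`
([IUTchI] Ex. 3.2 (iv)). Compared with p470383 `exists_qPinned_and_hull_pilotDataOfK_of_inSigma8`, the idele-profile binders are GONE.
[cite: Mochizuki2012, IUTchI Ex. 3.2 (iv) p. 71] [cite: DupuyHilado2025, §3.3, §3.4, §3.9] [claim: Mochizuki2012, status: disputed] -/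
theorem exists_qPinned_and_hull_pilotDataOfK_of_inSigma8_of_realises
    (ht0 : ∀ pp i x, t pp i x ≠ 0)
    (ht : ∀ (pp : Nat.Primes) (i : Fin (pilotDataOfK D K).lstar) (x : (thetaIndex (pilotDataOfK D K)).Fibre (.inr pp)),
      haveI : Fact (pp : ℕ).Prime := ⟨pp.2⟩
      Real.log ‖t pp i x‖ = -((pilotDataOfK D K).thetaPilot i (placeOf (pilotDataOfK D K) pp.1 x)) *
        logNorm K (placeOf (pilotDataOfK D K) pp.1 x) / localDegree K (placeOf (pilotDataOfK D K) pp.1 x))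
    (htq : ∀ (pp : Nat.Primes) (x : (thetaIndex (pilotDataOfK D K)).Fibre (.inr pp)),
      haveI : Fact (pp : ℕ).Prime := ⟨pp.2⟩
      Real.log ‖tq pp x‖ = -((pilotDataOfK D K).qPilot (placeOf (pilotDataOfK D K) pp.1 x)) *
        logNorm K (placeOf (pilotDataOfK D K) pp.1 x) / localDegree K (placeOf (pilotDataOfK D K) pp.1 x))
    (h : RH.InSigmaDatum.InSigma8 D) :
    ∃ (ρ' : (∀ v : (thetaIndex (pilotDataOfK D K)).V, v ∈ (thetaIndex (pilotDataOfK D K)).Vbad →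
            Set ((logShellsDH (pilotDataOfK D K) logv).StarPacket v)) →
          ∀ (j : (thetaIndex (pilotDataOfK D K)).Label) (vQ : (thetaIndex (pilotDataOfK D K)).VQ),
            Set ((logShellsDH (pilotDataOfK D K) logv).Packet j vQ))
        (qK : ∀ v : (thetaIndex (pilotDataOfK D K)).V, v ∈ (thetaIndex (pilotDataOfK D K)).Vbad →
          Set ((logShellsDH (pilotDataOfK D K) logv).StarPacket v)),
        QPinned ({ toSituation := situationPrVol (pilotDataOfK D K) hlog M archPk archSub Ψ act Mmod region, col := col } :
            LatticeSituation (thetaIndex (pilotDataOfK D K)))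
          (settingPrVolSharp (pilotDataOfK D K) hlog M archPk archSub Ψ act Mmod region n lat sig split qData tq t htq0 htq1) ρ' qK ∧
        PilotKummerCompatHull ({ toSituation := situationPrVol (pilotDataOfK D K) hlog M archPk archSub Ψ act Mmod region, col := col } :
            LatticeSituation (thetaIndex (pilotDataOfK D K)))
          (settingPrVolSharp (pilotDataOfK D K) hlog M archPk archSub Ψ act Mmod region n lat sig split qData tq t htq0 htq1) ρ' qK :=
  exists_qPinned_and_hull_settingPrVolSharp_of_hBand_of_realises (pilotDataOfK D K) hlog M archPk archSub Ψ act Mmod region n lat sig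
    split qData tq t htq0 htq1 col ht0 ht htq
    (fun w hw => by
      obtain ⟨P, hP, -, -⟩ := exists_nat_qPilot_pilotDataOfK D hw
      exact ⟨P, hP⟩) h

end Genuine

/-! ## §3. The CHOSEN realising ideles of the certificates of record: `InSigma8 D` alone gives the `hSHw` body -/

section Chosen

variable {F K Fbar : Type} [Field F] [NumberField F] [Field K] [NumberField K] [Algebra F K] [Field Fbar]
  [Algebra F Fbar] [Algebra K Fbar] {E : WeierstrassCurve F} [E.IsElliptic] {l : ℕ} {Pb : BadPlacePredicates K}
  (D : InitialThetaData F K Fbar E l Pb) (M : Type) [Field M] [NumberField M]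
  (archPk : ∀ (j : (thetaIndex (pilotDataOfK D K)).Label) (vQ : (thetaIndex (pilotDataOfK D K)).VQ),
    Set ((logShellsDH (pilotDataOfK D K) (analyticLogv K)).Packet j vQ))
  (archSub : ∀ (j : (thetaIndex (pilotDataOfK D K)).Label) (v : (thetaIndex (pilotDataOfK D K)).V),
    Set ((logShellsDH (pilotDataOfK D K) (analyticLogv K)).Packet j ((thetaIndex (pilotDataOfK D K)).over v)))
  (Ψ : ℤ → ∀ v : (thetaIndex (pilotDataOfK D K)).V, v ∈ (thetaIndex (pilotDataOfK D K)).Vbad →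
    Set ((logShellsDH (pilotDataOfK D K) (analyticLogv K)).StarPacket v))
  (act : ℤ → ∀ v : (thetaIndex (pilotDataOfK D K)).V, v ∈ (thetaIndex (pilotDataOfK D K)).Vbad →
    (logShellsDH (pilotDataOfK D K) (analyticLogv K)).StarPacket v →
      Module.End ℚ ((logShellsDH (pilotDataOfK D K) (analyticLogv K)).StarPacket v))
  (Mmod : ℤ → ∀ j : (thetaIndex (pilotDataOfK D K)).LabelStar, Set ((logShellsDH (pilotDataOfK D K) (analyticLogv K)).GlobalPacket j.1))
  (region : ℤ → ∀ j : (thetaIndex (pilotDataOfK D K)).LabelStar, FinDivisor M → ∀ vQ : (thetaIndex (pilotDataOfK D K)).VQ,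
    Set ((logShellsDH (pilotDataOfK D K) (analyticLogv K)).Packet j.1 vQ))
  (n : ℤ) {HT : Type} {LogLink : HT → HT → Type} {IsFull : ∀ {s t : HT}, LogLink s t → Prop}
  (lat : LGPGaussianLogThetaLattice LogLink IsFull)
  {Frd : Type} {IsoF : Frd → Frd → Type} {Ob : Frd → Type} {realify : Frd → Frd} {Strip : Type}
  {IsoS : Strip → Strip → Type}
  {Mv : ∀ v : (thetaIndex (pilotDataOfK D K)).V, v ∈ (thetaIndex (pilotDataOfK D K)).Vbad → Type} [∀ v h, Monoid (Mv v h)]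
  (sig : GlobalLGPFrobenioidSignature (thetaIndex (pilotDataOfK D K)).lstar (thetaIndex (pilotDataOfK D K)).V
    (· ∈ (thetaIndex (pilotDataOfK D K)).Vbad) Frd IsoF Ob realify Strip IsoS Mv)
  (split : SplittingMonoids Mv) {ObΔ : Type}
  {N : ∀ v : (thetaIndex (pilotDataOfK D K)).V, v ∈ (thetaIndex (pilotDataOfK D K)).Vbad → Type} [∀ v h, Monoid (N v h)]
  (qData : QPilotData ObΔ N)
  (col : ℤ → Column (logShellsDH (pilotDataOfK D K) (analyticLogv K)))

/-- **ROW 8 AT THE CERTIFICATES' CHOSEN IDELES — hypothesis `InSigma8 D` ONLY.** At the genuine bed with the coric shells of `analyticLogv K`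
and the realising q- and Θ-ideles CHOSEN in `Conditional.abc_of_SH_v10K_window` / `abc_of_SHSigma_v10K_window`
(`(exists_realising_qIdeles_pilotDataOfK D).choose`, `(exists_realising_thetaIdeles_pilotDataOfK D).choose`, p434046 lineage), a datum in the
height class satisfies «`∃ ρ qK, QPinned ∧ PilotKummerCompatHull`» (any columns `col`). [cite: Mochizuki2012, IUTchI Ex. 3.2 (iv) p. 71]
[cite: DupuyHilado2025, §3.3, §3.4, §3.9] [claim: Mochizuki2012, status: disputed] -/
theorem exists_qPinned_and_hull_pilotDataOfK_chosen_of_inSigma8 (h : RH.InSigmaDatum.InSigma8 D) :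
    ∃ (ρ' : (∀ v : (thetaIndex (pilotDataOfK D K)).V, v ∈ (thetaIndex (pilotDataOfK D K)).Vbad →
            Set ((logShellsDH (pilotDataOfK D K) (analyticLogv K)).StarPacket v)) →
          ∀ (j : (thetaIndex (pilotDataOfK D K)).Label) (vQ : (thetaIndex (pilotDataOfK D K)).VQ),
            Set ((logShellsDH (pilotDataOfK D K) (analyticLogv K)).Packet j vQ))
        (qK : ∀ v : (thetaIndex (pilotDataOfK D K)).V, v ∈ (thetaIndex (pilotDataOfK D K)).Vbad →
          Set ((logShellsDH (pilotDataOfK D K) (analyticLogv K)).StarPacket v)),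
        QPinned
          ({ toSituation := situationPrVol (pilotDataOfK D K) (logvAnalytic_analyticLogv (F := K)) M archPk archSub Ψ act Mmod region,
             col := col } : LatticeSituation (thetaIndex (pilotDataOfK D K)))
          (settingPrVolSharp (pilotDataOfK D K) (logvAnalytic_analyticLogv (F := K)) M archPk archSub Ψ act Mmod region n lat sig split
            qData (exists_realising_qIdeles_pilotDataOfK D).choose (exists_realising_thetaIdeles_pilotDataOfK D).choose
            (exists_realising_qIdeles_pilotDataOfK D).choose_spec.1 (exists_realising_qIdeles_pilotDataOfK D).choose_spec.2.1) ρ' qK ∧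
        PilotKummerCompatHull
          ({ toSituation := situationPrVol (pilotDataOfK D K) (logvAnalytic_analyticLogv (F := K)) M archPk archSub Ψ act Mmod region,
             col := col } : LatticeSituation (thetaIndex (pilotDataOfK D K)))
          (settingPrVolSharp (pilotDataOfK D K) (logvAnalytic_analyticLogv (F := K)) M archPk archSub Ψ act Mmod region n lat sig split
            qData (exists_realising_qIdeles_pilotDataOfK D).choose (exists_realising_thetaIdeles_pilotDataOfK D).choose
            (exists_realising_qIdeles_pilotDataOfK D).choose_spec.1 (exists_realising_qIdeles_pilotDataOfK D).choose_spec.2.1) ρ' qK :=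
  exists_qPinned_and_hull_pilotDataOfK_of_inSigma8_of_realises D M (logvAnalytic_analyticLogv (F := K)) archPk archSub Ψ act Mmod region
    n lat sig split qData (exists_realising_qIdeles_pilotDataOfK D).choose (exists_realising_thetaIdeles_pilotDataOfK D).choose
    (exists_realising_qIdeles_pilotDataOfK D).choose_spec.1 (exists_realising_qIdeles_pilotDataOfK D).choose_spec.2.1 col
    (exists_realising_thetaIdeles_pilotDataOfK D).choose_spec.1 (exists_realising_thetaIdeles_pilotDataOfK D).choose_spec.2.2
    (exists_realising_qIdeles_pilotDataOfK D).choose_spec.2.2 h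

include col in
/-- **… unbundled: the (xi-f) licence at EVERY label at the certificates' chosen ideles, from `InSigma8 D` alone** — literally what the binder
`hSHw` of `Conditional.abc_of_SH_v10K_window` / `hSHsw` of `abc_of_SHSigma_v10K_window` (`PilotKummerCompatHull _ _ (fun _ => qRegion) qK`) asks
of the datum: for window data in the height class that binder is DISCHARGED. [claim: Mochizuki2012, status: disputed] -/
theorem qRegion_subset_thetaHull_pilotDataOfK_chosen_of_inSigma8 (h : RH.InSigmaDatum.InSigma8 D)
    (j : (thetaIndex (pilotDataOfK D K)).Label) (vQ : (thetaIndex (pilotDataOfK D K)).VQ) :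
    (settingPrVolSharp (pilotDataOfK D K) (logvAnalytic_analyticLogv (F := K)) M archPk archSub Ψ act Mmod region n lat sig split
        qData (exists_realising_qIdeles_pilotDataOfK D).choose (exists_realising_thetaIdeles_pilotDataOfK D).choose
        (exists_realising_qIdeles_pilotDataOfK D).choose_spec.1 (exists_realising_qIdeles_pilotDataOfK D).choose_spec.2.1).qRegion j vQ ⊆
      (settingPrVolSharp (pilotDataOfK D K) (logvAnalytic_analyticLogv (F := K)) M archPk archSub Ψ act Mmod region n lat sig split
        qData (exists_realising_qIdeles_pilotDataOfK D).choose (exists_realising_thetaIdeles_pilotDataOfK D).choose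
        (exists_realising_qIdeles_pilotDataOfK D).choose_spec.1 (exists_realising_qIdeles_pilotDataOfK D).choose_spec.2.1).thetaHull j vQ :=
  (Conditional.Antecedent.exists_qPinned_and_hull_iff
    ({ toSituation := situationPrVol (pilotDataOfK D K) (logvAnalytic_analyticLogv (F := K)) M archPk archSub Ψ act Mmod region,
       col := col } : LatticeSituation (thetaIndex (pilotDataOfK D K))) _).1
    (exists_qPinned_and_hull_pilotDataOfK_chosen_of_inSigma8 D M archPk archSub Ψ act Mmod region n lat sig split qData col h) j vQ

end Chosen

end Summit.ABC.IUTFork.Repair.RHHeightClassRealising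

end
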